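import Mathlib.NumberTheory.NumberField.CanonicalEmbedding.Basic
import Mathlib.LinearAlgebra.Complex.Module
import Mathlib.Analysis.Complex.Basic
import HarnessLib

/-!
# Complex embeddings extend to continuous real-algebra morphisms `K_∞ = K ⊗_ℚ ℝ → ℂ`

Topic `NumberTheory/Automorphic`; namespace `Literature.NumberTheory.Automorphic`.
Definitions with bodies and theorems; no named fact, no `sorry`.

For a field `K` and Mathlib's mixed space `mixedSpace K = ℝ^{r₁} × ℂ^{r₂}` (`K_∞` when `K` is a
number field; the coefficient algebra of the tree's archimedean group `archGroupGL n K`):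

* `evalRealAlgHom K w`, `evalComplexAlgHom K w : mixedSpace K →ₐ[ℝ] ℂ` — evaluation at a real
  (coerced to `ℂ`) or complex place, as REAL-ALGEBRA morphisms (the tree's `mixedSpaceEvalReal`,
  `mixedSpaceEvalComplex` of `AdelicGLnGlue` are the ring-hom versions), continuous;
* `embeddingExt τ : mixedSpace K →ₐ[ℝ] ℂ` — **the real-algebra morphism `τ̃` extending a complex
  embedding `τ : K →+* ℂ`** (evaluation at the place of `τ`, composed with complex conjugation
  when `τ` is the conjugate of the chosen embedding of a complex place);
  `continuous_embeddingExt`, and `embeddingExt_mixedEmbedding` /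
  `embeddingExt_comp_mixedEmbedding` — **`τ̃ ∘ ι_∞ = τ`** for the mixed embedding
  `ι_∞ = mixedEmbedding K : K → K_∞` [cite: BorelJacquet1979, §1.1 and §4.1].

Through `τ̃` the algebraic coefficient systems `⨂_τ V_λ ∘ GL_n(τ)` of the cohomology of
arithmetic groups become representations of `G_∞ = GL_n(K_∞)` (`GKModulePhiStandardRep`).

## Mathlib / Literature search

`NumberField.mixedEmbedding`, `mixedEmbedding_apply_isReal/isComplex`, `embedding_mk_eq`,
`embedding_mk_eq_of_isReal`, `isReal_of_mk_isReal`, `Complex.conjAe`, `Complex.ofRealAm`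
(Mathlib).  `lean search 'mixedSpace . →ₐ\[ℝ\] ℂ'`: no real-algebra-hom version in the tree.

## References

* A. Borel, H. Jacquet (1979), §1.1, §4.1 (`G_∞ = ∏_{v ∣ ∞} G_v`) [BorelJacquet1979].
-/

noncomputable section

namespace Literature.NumberTheory.Automorphic

open NumberField NumberField.InfinitePlace NumberField.mixedEmbedding

variable (K : Type*) [Field K]

/-- Evaluation of `K_∞ = ℝ^{r₁} × ℂ^{r₂}` at a real place, read in `ℂ`, as a real-algebra morphism.
[folklore] -/
def evalRealAlgHom (w : {w : InfinitePlace K // w.IsReal}) : mixedSpace K →ₐ[ℝ] ℂ :=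
  Complex.ofRealAm.comp ((Pi.evalAlgHom ℝ (fun _ => ℝ) w).comp (AlgHom.fst ℝ _ _))

/-- Evaluation of `K_∞` at a complex place as a real-algebra morphism. [folklore] -/
def evalComplexAlgHom (w : {w : InfinitePlace K // w.IsComplex}) : mixedSpace K →ₐ[ℝ] ℂ :=
  (Pi.evalAlgHom ℝ (fun _ => ℂ) w).comp (AlgHom.snd ℝ _ _)

/-- Unfolding. [folklore] -/
@[simp] theorem evalRealAlgHom_apply (w : {w : InfinitePlace K // w.IsReal}) (x : mixedSpace K) :
    evalRealAlgHom K w x = ((x.1 w : ℝ) : ℂ) := rfl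

/-- Unfolding. [folklore] -/
@[simp] theorem evalComplexAlgHom_apply (w : {w : InfinitePlace K // w.IsComplex})
    (x : mixedSpace K) : evalComplexAlgHom K w x = x.2 w := rfl

/-- Continuity. [folklore] -/
theorem continuous_evalRealAlgHom (w : {w : InfinitePlace K // w.IsReal}) :
    Continuous (evalRealAlgHom K w) :=
  Complex.continuous_ofReal.comp ((continuous_apply w).comp continuous_fst)

/-- Continuity. [folklore] -/
theorem continuous_evalComplexAlgHom (w : {w : InfinitePlace K // w.IsComplex}) :
    Continuous (evalComplexAlgHom K w) :=
  (continuous_apply w).comp continuous_snd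

variable {K}

open scoped ComplexConjugate in
/-- **The continuous real-algebra morphism `τ̃ : K_∞ → ℂ` extending a complex embedding
`τ : K → ℂ`**: evaluation at the place `w` of `τ` (coerced to `ℂ` if `w` is real; composed with
complex conjugation if `w` is complex and `τ` is the conjugate of the chosen embedding of `w`).
[cite: BorelJacquet1979, §1.1 and §4.1] -/
def embeddingExt (τ : K →+* ℂ) : mixedSpace K →ₐ[ℝ] ℂ := by
  classical
  exact if hw : (mk τ).IsReal then evalRealAlgHom K ⟨mk τ, hw⟩
    else if (mk τ).embedding = τ then
      evalComplexAlgHom K ⟨mk τ, not_isReal_iff_isComplex.mp hw⟩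
    else Complex.conjAe.toAlgHom.comp (evalComplexAlgHom K ⟨mk τ, not_isReal_iff_isComplex.mp hw⟩)

/-- The real case. [folklore] -/
theorem embeddingExt_of_isReal {τ : K →+* ℂ} (hw : (mk τ).IsReal) :
    embeddingExt τ = evalRealAlgHom K ⟨mk τ, hw⟩ := by
  classical
  exact dif_pos hw

/-- The complex case, `τ` the chosen embedding. [folklore] -/
theorem embeddingExt_of_eq {τ : K →+* ℂ} (hw : ¬ (mk τ).IsReal) (h : (mk τ).embedding = τ) :
    embeddingExt τ = evalComplexAlgHom K ⟨mk τ, not_isReal_iff_isComplex.mp hw⟩ := by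
  classical
  exact (dif_neg hw).trans (if_pos h)

/-- The complex case, `τ` the conjugate embedding. [folklore] -/
theorem embeddingExt_of_ne {τ : K →+* ℂ} (hw : ¬ (mk τ).IsReal) (h : (mk τ).embedding ≠ τ) :
    embeddingExt τ = Complex.conjAe.toAlgHom.comp
      (evalComplexAlgHom K ⟨mk τ, not_isReal_iff_isComplex.mp hw⟩) := by
  classical
  exact (dif_neg hw).trans (if_neg h)

/-- `τ̃` is continuous. [folklore] -/
theorem continuous_embeddingExt (τ : K →+* ℂ) : Continuous (embeddingExt τ) := by
  by_cases hw : (mk τ).IsReal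
  · rw [embeddingExt_of_isReal hw]
    exact continuous_evalRealAlgHom K _
  · by_cases h : (mk τ).embedding = τ
    · rw [embeddingExt_of_eq hw h]
      exact continuous_evalComplexAlgHom K _
    · rw [embeddingExt_of_ne hw h]
      exact Complex.continuous_conj.comp (continuous_evalComplexAlgHom K _)

/-- **`τ̃` extends `τ`**: `τ̃ (ι_∞ x) = τ x` for the mixed embedding `ι_∞ : K → K_∞`.
[cite: BorelJacquet1979, §1.1] -/
theorem embeddingExt_mixedEmbedding (τ : K →+* ℂ) (x : K) :
    embeddingExt τ (mixedEmbedding K x) = τ x := by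
  by_cases hw : (mk τ).IsReal
  · rw [embeddingExt_of_isReal hw, evalRealAlgHom_apply, mixedEmbedding_apply_isReal,
      embedding_of_isReal_apply, embedding_mk_eq_of_isReal (isReal_of_mk_isReal hw)]
  · by_cases h : (mk τ).embedding = τ
    · rw [embeddingExt_of_eq hw h, evalComplexAlgHom_apply, mixedEmbedding_apply_isComplex]
      exact congrFun (congrArg DFunLike.coe h) x
    · rw [embeddingExt_of_ne hw h, AlgHom.comp_apply, evalComplexAlgHom_apply,
        mixedEmbedding_apply_isComplex]
      have h' : (mk τ).embedding = ComplexEmbedding.conjugate τ :=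
        (embedding_mk_eq τ).resolve_left h
      change Complex.conjAe ((mk τ).embedding x) = τ x
      rw [h', ComplexEmbedding.conjugate_coe_eq, Complex.conjAe_coe, Complex.conj_conj]

/-- The same as an identity of ring homomorphisms `τ̃ ∘ ι_∞ = τ`. [folklore] -/
theorem embeddingExt_comp_mixedEmbedding (τ : K →+* ℂ) :
    (embeddingExt τ : mixedSpace K →+* ℂ).comp (mixedEmbedding K) = τ :=
  RingHom.ext (embeddingExt_mixedEmbedding τ)

end Literature.NumberTheory.Automorphic
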